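import Literature.Analysis.FluidPDE.PassiveVectorClass
import HarnessLib

/-!
# `L²` distributional solutions of the passive solenoidal vector equation: the time-sliced identity

Analysis/FluidPDE proof-support file (everything proved; no definitions). For a space–time field
`w ∈ L¹((0,T) × T^d)` with `‖b‖‖w‖ ∈ L¹` satisfying the weak formulation of the passive solenoidal vector
equation (`A = 0`; Yoshida–Kaneda 2000 (4)–(5)) against smooth divergence-free space–time tests, in the
product-measure form
`∫_{μ_T} ⟪w, ∂ₜΨ + (b·∇)Ψ + νΔΨ⟫ + ∫⟪w₀, Ψ(0)⟫ = 0`,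
WITHOUT the `L^∞_t L²_x` bound of the class `Torus.IsWeakPassiveVectorOn` (this is what J.-L. Lions'
`L²(μ_T)` solutions of `PassiveVectorLionsWeak` provide), we derive the time-sliced identity against a steady
smooth divergence-free field `G` (Temam 1984, Ch. III §1.1, (1.11); du Bois-Reymond with datum): for a.e. `t`,
`∫⟪w(t), G⟫ = ∫⟪w₀, G⟫ + ∫_{(0,t]} ∫⟪w, (b·∇)G + νΔG⟫`
(`ae_integral_inner_eq_of_weak`), the input of the Galerkin energy argument that upgrades such solutions to
`L^∞_t L²_x` (support item `CascadeBookkeeping`, cell `ad-ideate`). The computation is that of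
`PassiveVectorClass.setIntegral_test_smul`, with the class replaced by the two integrability hypotheses.

## References

* R. Temam, *Navier–Stokes Equations*, 3rd ed. (1984), Ch. III §1.1, (1.11). [`Temam1984`]
* K. Yoshida, Y. Kaneda, Phys. Rev. E 63 (2000) 016308, §II eq. (4)–(5). [`YoshidaKaneda2000`]
-/

noncomputable section

open MeasureTheory Set Filter Function TopologicalSpace
open scoped ENNReal NNReal InnerProductSpace ContDiff

namespace Literature.Analysis.FluidPDE

namespace Torus

variable {d : Type*} [Fintype d] [DecidableEq d]

section L2Weak

variable {T ν : ℝ} {b w : ℝ → UnitAddTorus d → EuclideanSpace ℝ d} {w₀ : UnitAddTorus d → EuclideanSpace ℝ d}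

omit [DecidableEq d] in
/-- Points of `(0,T) × T^d` have their time coordinate in `(0,T)`, a.e. [folklore] -/
private theorem ae_fst_mem_Ioo₃ (T : ℝ) :
    ∀ᵐ p : ℝ × UnitAddTorus d ∂(((volume : Measure ℝ).restrict (Ioo 0 T)).prod volume), p.1 ∈ Ioo 0 T :=
  (Measure.quasiMeasurePreserving_fst (μ := (volume : Measure ℝ).restrict (Ioo 0 T))
    (ν := (volume : Measure (UnitAddTorus d)))).ae (ae_restrict_mem measurableSet_Ioo)

omit [DecidableEq d] in
/-- Integrability on `(0,T) × T^d` of `⟪w, Φ⟫` for `w ∈ L¹` and a jointly continuous field `Φ`.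
[cite: Temam1984, Ch. III §1.1] -/
theorem integrable_inner_of_integrable_of_continuous
    (hw : Integrable (uncurry w) (((volume : Measure ℝ).restrict (Ioo 0 T)).prod volume))
    {Φ : ℝ → UnitAddTorus d → EuclideanSpace ℝ d} (hΦ : Continuous (uncurry Φ)) :
    Integrable (fun p : ℝ × UnitAddTorus d => ⟪w p.1 p.2, Φ p.1 p.2⟫_ℝ)
      (((volume : Measure ℝ).restrict (Ioo 0 T)).prod volume) := by
  obtain ⟨C₀, hC₀⟩ := exists_bound_of_continuous_uncurry hΦ 0 T
  refine Integrable.mono' (g := fun p : ℝ × UnitAddTorus d => ‖uncurry w p‖ * C₀) (hw.norm.mul_const C₀)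
    (hw.1.inner hΦ.aestronglyMeasurable) ?_
  filter_upwards [ae_fst_mem_Ioo₃ (d := d) T] with p hp
  exact (norm_inner_le_norm _ _).trans (mul_le_mul_of_nonneg_left (hC₀ p.1 (Ioo_subset_Icc_self hp) p.2) (norm_nonneg _))

/-- Integrability on `(0,T) × T^d` of the transport pairing `⟪w, (b·∇)Φ⟫ = ∑ⱼ bⱼ⟪w, ∂ⱼΦ⟫` for
`‖b‖‖w‖ ∈ L¹` and a field `Φ` smooth in space with jointly continuous partial derivatives.
[cite: Temam1984, Ch. III §1.1] -/
theorem integrable_inner_convect_of_integrable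
    (hw : Integrable (uncurry w) (((volume : Measure ℝ).restrict (Ioo 0 T)).prod volume))
    (hbm : AEStronglyMeasurable (uncurry b) (((volume : Measure ℝ).restrict (Ioo 0 T)).prod volume))
    (hbw : Integrable (fun p : ℝ × UnitAddTorus d => ‖b p.1 p.2‖ * ‖w p.1 p.2‖)
      (((volume : Measure ℝ).restrict (Ioo 0 T)).prod volume))
    {Φ : ℝ → UnitAddTorus d → EuclideanSpace ℝ d} (hΦ1 : ∀ t, FunctionSpaces.Torus.IsContDiff 1 (Φ t))
    (hΦd : ∀ j, Continuous (uncurry fun t x => FunctionSpaces.Torus.partialDeriv j (Φ t) x)) :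
    Integrable (fun p : ℝ × UnitAddTorus d => ⟪w p.1 p.2, FunctionSpaces.Torus.convect (b p.1) (Φ p.1) p.2⟫_ℝ)
      (((volume : Measure ℝ).restrict (Ioo 0 T)).prod volume) := by
  have e : (fun p : ℝ × UnitAddTorus d => ⟪w p.1 p.2, FunctionSpaces.Torus.convect (b p.1) (Φ p.1) p.2⟫_ℝ) =
      fun p => ∑ j, b p.1 p.2 j * ⟪w p.1 p.2, FunctionSpaces.Torus.partialDeriv j (Φ p.1) p.2⟫_ℝ := by
    funext p
    exact IsWeakPassiveVectorOn.inner_convect_eq_sum' (hΦ1 p.1) _ _ _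
  rw [e]
  refine integrable_finsetSum _ fun j _ => ?_
  obtain ⟨C₀, hC₀⟩ := exists_bound_of_continuous_uncurry (hΦd j) 0 T
  have hm : AEStronglyMeasurable (fun p : ℝ × UnitAddTorus d =>
      b p.1 p.2 j * ⟪w p.1 p.2, FunctionSpaces.Torus.partialDeriv j (Φ p.1) p.2⟫_ℝ)
      (((volume : Measure ℝ).restrict (Ioo 0 T)).prod volume) :=
    ((EuclideanSpace.proj j).continuous.comp_aestronglyMeasurable hbm).mul (hw.1.inner (hΦd j).aestronglyMeasurable)
  refine Integrable.mono' (g := fun p : ℝ × UnitAddTorus d => ‖b p.1 p.2‖ * ‖w p.1 p.2‖ * C₀) (hbw.mul_const C₀) hm ?_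
  filter_upwards [ae_fst_mem_Ioo₃ (d := d) T] with p hp
  rw [norm_mul]
  calc ‖b p.1 p.2 j‖ * ‖⟪w p.1 p.2, FunctionSpaces.Torus.partialDeriv j (Φ p.1) p.2⟫_ℝ‖
      ≤ ‖b p.1 p.2‖ * (‖w p.1 p.2‖ * C₀) :=
        mul_le_mul (by simpa [Real.norm_eq_abs] using FunctionSpaces.Torus.abs_apply_le_norm (b p.1 p.2) j)
          ((norm_inner_le_norm _ _).trans (mul_le_mul_of_nonneg_left (hC₀ p.1 (Ioo_subset_Icc_self hp) p.2)
            (norm_nonneg _))) (norm_nonneg _) (norm_nonneg _)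
    _ = ‖b p.1 p.2‖ * ‖w p.1 p.2‖ * C₀ := by ring

/-- **The weak formulation tested with `η(t) G(x)`** for an `L²`-type distributional solution: for a smooth
compactly supported `η` with `tsupport η ⊆ (-∞,T)` and a smooth divergence-free steady field `G`,
`∫_{(0,T)} (η'(t)∫⟪w(t),G⟫ + η(t)∫⟪w(t),(b(t)·∇)G + νΔG⟫) dt + η(0)∫⟪w₀,G⟫ = 0`
(Temam 1984, Ch. III §1.1 (1.11)). [cite: Temam1984, Ch. III §1.1 (1.11)] -/
theorem setIntegral_test_smul_of_weak
    (hw : Integrable (uncurry w) (((volume : Measure ℝ).restrict (Ioo 0 T)).prod volume))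
    (hbm : AEStronglyMeasurable (uncurry b) (((volume : Measure ℝ).restrict (Ioo 0 T)).prod volume))
    (hbw : Integrable (fun p : ℝ × UnitAddTorus d => ‖b p.1 p.2‖ * ‖w p.1 p.2‖)
      (((volume : Measure ℝ).restrict (Ioo 0 T)).prod volume))
    (hweak : ∀ Ψ : ℝ → UnitAddTorus d → EuclideanSpace ℝ d, FunctionSpaces.Torus.IsSpaceTimeTest T Ψ →
      (∀ t, FunctionSpaces.Torus.IsDivFree (Ψ t)) →
      (∫ p, ⟪w p.1 p.2, FunctionSpaces.Torus.timeDeriv Ψ p.1 p.2 +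
          FunctionSpaces.Torus.convect (b p.1) (Ψ p.1) p.2 + ν • FunctionSpaces.Torus.laplacian (Ψ p.1) p.2⟫_ℝ
          ∂(((volume : Measure ℝ).restrict (Ioo 0 T)).prod volume)) + ∫ x, ⟪w₀ x, Ψ 0 x⟫_ℝ = 0)
    {η : ℝ → ℝ} (hη : ContDiff ℝ ∞ η) (hηc : HasCompactSupport η) (hηT : tsupport η ⊆ Iio T)
    {G : UnitAddTorus d → EuclideanSpace ℝ d} (hG : FunctionSpaces.Torus.IsSmooth G)
    (hGdiv : FunctionSpaces.Torus.IsDivFree G) :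
    (∫ t in Ioo 0 T, ((deriv η t * ∫ x, ⟪w t x, G x⟫_ℝ) +
      η t * ∫ x, ⟪w t x, FunctionSpaces.Torus.convect (b t) G x + ν • FunctionSpaces.Torus.laplacian G x⟫_ℝ)) +
      η 0 * ∫ x, ⟪w₀ x, G x⟫_ℝ = 0 := by
  have hΨ := isSpaceTimeTest_smul_const hη hηc hηT hG
  have hG1 : FunctionSpaces.Torus.IsContDiff 1 G := hG.isContDiff (by simp)
  have hΨdiv : ∀ t, FunctionSpaces.Torus.IsDivFree ((fun t x => η t • G x) t) := by
    intro t x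
    have h : ∀ i : d, FunctionSpaces.Torus.partialDeriv i (fun y => ((fun t x => η t • G x) t) y i) x =
        η t * FunctionSpaces.Torus.partialDeriv i (fun y => G y i) x := by
      intro i
      have e : (fun y => ((fun t x => η t • G x) t) y i) = fun y => η t * G y i := by
        funext y; simp [smul_eq_mul]
      rw [e]
      simp only [FunctionSpaces.Torus.partialDeriv, FunctionSpaces.Torus.lineDeriv, deriv_const_mul_field']
    unfold FunctionSpaces.Torus.divergence
    simp_rw [h]
    rw [← Finset.mul_sum]
    have h0 := hGdiv x
    unfold FunctionSpaces.Torus.divergence at h0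
    rw [h0, mul_zero]
  have key := hweak _ hΨ hΨdiv
  set P : Measure (ℝ × UnitAddTorus d) := ((volume : Measure ℝ).restrict (Ioo 0 T)).prod volume with hP
  have hpt : ∀ p : ℝ × UnitAddTorus d,
      ⟪w p.1 p.2, FunctionSpaces.Torus.timeDeriv (fun t x => η t • G x) p.1 p.2 +
          FunctionSpaces.Torus.convect (b p.1) ((fun t x => η t • G x) p.1) p.2 +
          ν • FunctionSpaces.Torus.laplacian ((fun t x => η t • G x) p.1) p.2⟫_ℝ =
      deriv η p.1 * ⟪w p.1 p.2, G p.2⟫_ℝ +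
        η p.1 * ⟪w p.1 p.2, FunctionSpaces.Torus.convect (b p.1) G p.2 + ν • FunctionSpaces.Torus.laplacian G p.2⟫_ℝ := by
    intro p
    rw [timeDeriv_smul_const (hη.differentiable (by simp)),
      show ((fun t x => η t • G x) p.1) = η p.1 • G from rfl]
    simp only [FunctionSpaces.Torus.convect]
    rw [FunctionSpaces.Torus.fderiv_const_smul hG1, FunctionSpaces.Torus.laplacian_const_smul_apply hG]
    simp only [FunLike.coe_smul, Pi.smul_apply, inner_add_right, real_inner_smul_right]
    ring
  have hGc : Continuous (uncurry fun (_ : ℝ) (x : UnitAddTorus d) => G x) := hG.continuous.comp continuous_snd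
  have hGd : ∀ j, Continuous (uncurry fun (_ : ℝ) (x : UnitAddTorus d) => FunctionSpaces.Torus.partialDeriv j G x) :=
    fun j => (hG.partialDeriv j).continuous.comp continuous_snd
  have hGl : Continuous (uncurry fun (_ : ℝ) (x : UnitAddTorus d) => FunctionSpaces.Torus.laplacian G x) :=
    hG.laplacian.continuous.comp continuous_snd
  have hI₁ : Integrable (fun p : ℝ × UnitAddTorus d => ⟪w p.1 p.2, G p.2⟫_ℝ) P :=
    integrable_inner_of_integrable_of_continuous hw hGc
  have hI₂ : Integrable (fun p : ℝ × UnitAddTorus d =>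
      ⟪w p.1 p.2, FunctionSpaces.Torus.convect (b p.1) G p.2 + ν • FunctionSpaces.Torus.laplacian G p.2⟫_ℝ) P := by
    have e : (fun p : ℝ × UnitAddTorus d =>
        ⟪w p.1 p.2, FunctionSpaces.Torus.convect (b p.1) G p.2 + ν • FunctionSpaces.Torus.laplacian G p.2⟫_ℝ) =
        fun p => ⟪w p.1 p.2, FunctionSpaces.Torus.convect (b p.1) ((fun (_ : ℝ) x => G x) p.1) p.2⟫_ℝ +
          ν * ⟪w p.1 p.2, (fun (_ : ℝ) x => FunctionSpaces.Torus.laplacian G x) p.1 p.2⟫_ℝ := by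
      funext p
      rw [inner_add_right, real_inner_smul_right]
    rw [e]
    exact (integrable_inner_convect_of_integrable hw hbm hbw (fun _ => hG1) hGd).add
      ((integrable_inner_of_integrable_of_continuous hw hGl).const_mul ν)
  obtain ⟨Ca, hCa⟩ := (hη.continuous_deriv (by simp)).bounded_above_of_compact_support hηc.deriv
  obtain ⟨Cb, hCb⟩ := hη.continuous.bounded_above_of_compact_support hηc
  set f₁ : ℝ × UnitAddTorus d → ℝ := fun p => deriv η p.1 * ⟪w p.1 p.2, G p.2⟫_ℝ with hf₁
  set f₂ : ℝ × UnitAddTorus d → ℝ := fun p =>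
    η p.1 * ⟪w p.1 p.2, FunctionSpaces.Torus.convect (b p.1) G p.2 + ν • FunctionSpaces.Torus.laplacian G p.2⟫_ℝ with hf₂
  have hf₁i : Integrable f₁ P :=
    hI₁.bdd_mul ((hη.continuous_deriv (by simp)).comp continuous_fst).aestronglyMeasurable (Eventually.of_forall fun p => hCa p.1)
  have hf₂i : Integrable f₂ P :=
    hI₂.bdd_mul (hη.continuous.comp continuous_fst).aestronglyMeasurable (Eventually.of_forall fun p => hCb p.1)
  have esum : (∫ p, (f₁ p + f₂ p) ∂P) + η 0 * ∫ x, ⟪w₀ x, G x⟫_ℝ = 0 := by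
    have e1 : ∫ p, (f₁ p + f₂ p) ∂P = ∫ p,
        ⟪w p.1 p.2, FunctionSpaces.Torus.timeDeriv (fun t x => η t • G x) p.1 p.2 +
            FunctionSpaces.Torus.convect (b p.1) ((fun t x => η t • G x) p.1) p.2 +
            ν • FunctionSpaces.Torus.laplacian ((fun t x => η t • G x) p.1) p.2⟫_ℝ ∂P :=
      integral_congr_ae (Eventually.of_forall fun p => (hpt p).symm)
    have e2 : η 0 * ∫ x, ⟪w₀ x, G x⟫_ℝ = ∫ x, ⟪w₀ x, (fun t x => η t • G x) 0 x⟫_ℝ := by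
      rw [← integral_const_mul]
      refine integral_congr_ae (Eventually.of_forall fun x => ?_)
      simp only [real_inner_smul_right]
    rw [e1, e2]
    exact key
  have e₁ : ∫ p, f₁ p ∂P = ∫ t in Ioo 0 T, deriv η t * ∫ x, ⟪w t x, G x⟫_ℝ := by
    rw [hP, integral_prod _ hf₁i]
    refine integral_congr_ae (Eventually.of_forall fun t => ?_)
    simp only [hf₁]
    exact integral_const_mul _ _
  have e₂ : ∫ p, f₂ p ∂P = ∫ t in Ioo 0 T, η t * ∫ x,
      ⟪w t x, FunctionSpaces.Torus.convect (b t) G x + ν • FunctionSpaces.Torus.laplacian G x⟫_ℝ := by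
    rw [hP, integral_prod _ hf₂i]
    refine integral_congr_ae (Eventually.of_forall fun t => ?_)
    simp only [hf₂]
    exact integral_const_mul _ _
  have ha : Integrable (fun t => deriv η t * ∫ x, ⟪w t x, G x⟫_ℝ) (volume.restrict (Ioo 0 T)) := by
    refine hf₁i.integral_prod_left.congr (Eventually.of_forall fun t => ?_)
    simp only [hf₁]
    exact integral_const_mul _ _
  have hb' : Integrable (fun t => η t * ∫ x,
      ⟪w t x, FunctionSpaces.Torus.convect (b t) G x + ν • FunctionSpaces.Torus.laplacian G x⟫_ℝ)
      (volume.restrict (Ioo 0 T)) := by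
    refine hf₂i.integral_prod_left.congr (Eventually.of_forall fun t => ?_)
    simp only [hf₂]
    exact integral_const_mul _ _
  rw [integral_add hf₁i hf₂i, e₁, e₂, ← integral_add ha hb'] at esum
  exact esum

/-- **Time-sliced identity for `L²`-type distributional solutions**: under the hypotheses of
`setIntegral_test_smul_of_weak`, for a smooth divergence-free steady field `G` and a.e. `t ∈ (0,T)`,
`∫⟪w(t), G⟫ = ∫⟪w₀, G⟫ + ∫_{(0,t]} ∫⟪w(τ), (b(τ)·∇)G + νΔG⟫ dτ` (du Bois-Reymond with datum).
[cite: Temam1984, Ch. III §1.1 (1.11)] -/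
theorem ae_integral_inner_eq_of_weak
    (hw : Integrable (uncurry w) (((volume : Measure ℝ).restrict (Ioo 0 T)).prod volume))
    (hbm : AEStronglyMeasurable (uncurry b) (((volume : Measure ℝ).restrict (Ioo 0 T)).prod volume))
    (hbw : Integrable (fun p : ℝ × UnitAddTorus d => ‖b p.1 p.2‖ * ‖w p.1 p.2‖)
      (((volume : Measure ℝ).restrict (Ioo 0 T)).prod volume))
    (hweak : ∀ Ψ : ℝ → UnitAddTorus d → EuclideanSpace ℝ d, FunctionSpaces.Torus.IsSpaceTimeTest T Ψ →
      (∀ t, FunctionSpaces.Torus.IsDivFree (Ψ t)) →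
      (∫ p, ⟪w p.1 p.2, FunctionSpaces.Torus.timeDeriv Ψ p.1 p.2 +
          FunctionSpaces.Torus.convect (b p.1) (Ψ p.1) p.2 + ν • FunctionSpaces.Torus.laplacian (Ψ p.1) p.2⟫_ℝ
          ∂(((volume : Measure ℝ).restrict (Ioo 0 T)).prod volume)) + ∫ x, ⟪w₀ x, Ψ 0 x⟫_ℝ = 0)
    {G : UnitAddTorus d → EuclideanSpace ℝ d} (hG : FunctionSpaces.Torus.IsSmooth G)
    (hGdiv : FunctionSpaces.Torus.IsDivFree G) :
    (IntegrableOn (fun τ => ∫ x, ⟪w τ x, FunctionSpaces.Torus.convect (b τ) G x + ν • FunctionSpaces.Torus.laplacian G x⟫_ℝ)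
      (Ioo 0 T)) ∧
    ∀ᵐ t ∂(volume.restrict (Ioo 0 T)),
      ∫ x, ⟪w t x, G x⟫_ℝ = (∫ x, ⟪w₀ x, G x⟫_ℝ) +
        ∫ τ in Ioc 0 t, ∫ x, ⟪w τ x, FunctionSpaces.Torus.convect (b τ) G x + ν • FunctionSpaces.Torus.laplacian G x⟫_ℝ := by
  have hG1 : FunctionSpaces.Torus.IsContDiff 1 G := hG.isContDiff (by simp)
  have hGc : Continuous (uncurry fun (_ : ℝ) (x : UnitAddTorus d) => G x) := hG.continuous.comp continuous_snd
  have hGd : ∀ j, Continuous (uncurry fun (_ : ℝ) (x : UnitAddTorus d) => FunctionSpaces.Torus.partialDeriv j G x) :=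
    fun j => (hG.partialDeriv j).continuous.comp continuous_snd
  have hGl : Continuous (uncurry fun (_ : ℝ) (x : UnitAddTorus d) => FunctionSpaces.Torus.laplacian G x) :=
    hG.laplacian.continuous.comp continuous_snd
  have hU : IntegrableOn (fun t => ∫ x, ⟪w t x, G x⟫_ℝ) (Ioo 0 T) volume :=
    (integrable_inner_of_integrable_of_continuous hw hGc).integral_prod_left
  have hI₂ : Integrable (fun p : ℝ × UnitAddTorus d =>
      ⟪w p.1 p.2, FunctionSpaces.Torus.convect (b p.1) G p.2 + ν • FunctionSpaces.Torus.laplacian G p.2⟫_ℝ)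
      (((volume : Measure ℝ).restrict (Ioo 0 T)).prod volume) := by
    have e : (fun p : ℝ × UnitAddTorus d =>
        ⟪w p.1 p.2, FunctionSpaces.Torus.convect (b p.1) G p.2 + ν • FunctionSpaces.Torus.laplacian G p.2⟫_ℝ) =
        fun p => ⟪w p.1 p.2, FunctionSpaces.Torus.convect (b p.1) ((fun (_ : ℝ) x => G x) p.1) p.2⟫_ℝ +
          ν * ⟪w p.1 p.2, (fun (_ : ℝ) x => FunctionSpaces.Torus.laplacian G x) p.1 p.2⟫_ℝ := by
      funext p
      rw [inner_add_right, real_inner_smul_right]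
    rw [e]
    exact (integrable_inner_convect_of_integrable hw hbm hbw (fun _ => hG1) hGd).add
      ((integrable_inner_of_integrable_of_continuous hw hGl).const_mul ν)
  have hF : IntegrableOn (fun t =>
      ∫ x, ⟪w t x, FunctionSpaces.Torus.convect (b t) G x + ν • FunctionSpaces.Torus.laplacian G x⟫_ℝ) (Ioo 0 T) volume :=
    hI₂.integral_prod_left
  exact ⟨hF, FunctionSpaces.ae_eq_add_setIntegral_of_forall_test hU hF fun η hη hηc hηT =>
    setIntegral_test_smul_of_weak hw hbm hbw hweak hη hηc hηT hG hGdiv⟩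

end L2Weak

end Torus

end Literature.Analysis.FluidPDE

end
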